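/-
Copyright: statement-level skeleton of a published paper (lit-balaban cell, Phase-2 proof seat p30). No proof claims
beyond what the kernel checks below.
-/
import Literature.MathematicalPhysics.QuantumFieldTheory.BalabanImbrieJaffe1984to88.BIJ85AppAStatements

/-!
# `BalabanImbrieJaffe1984to88.BIJ85Eq317Proof` — T. Bałaban, J. Imbrie, A. Jaffe, *Renormalization of the Higgs model:
minimizers, propagators and the stability of mean field theory*, Commun. Math. Phys. **97** (1985) 299–329
[BalabanImbrieJaffe1985]: Sect. 3 (the k = 1 illustration), **(3.15)–(3.18)** p. 307 — the gauge-field fluctuation form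
after one step, *"By the Appendix, with α = ∂ and B = L^{−d/2}Q^{e*}F … Then by Corollary A2"*, PROVED by instantiating the
tree's Proposition A1 / Corollary A2 (`BIJ85AppAStatements.corA2`, `hForm_min_eq`, `propA1_min`)

statement-level skeleton of published theorems with citation tags; proofs where landed; nothing here is a claim about the Yang–Mills mass gap

PDF held: `paper:balaban1985-cmp97-bij-higgs-minimizers` (journal page = PDF page + 298).  Render read as an image: p. 307
(`HOME/lit-balaban-r15/pages/1985-cmp97-bij-higgs-minimizers-p009-x2.png`); Appendix p. 326–327 via `BIJ85AppAStatements`.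

CITATION HEADER (lean-in-tree rule).  Part of the lit-balaban TYPED SKELETON (HOME `run/shared/lean/pub/lit-balaban/`):
WHAT IS REPRODUCED = rows **C1.Eq3.15-3.16** and **C1.Eq3.17-3.18** of `HOME/lit-balaban-r15/ROWS-C1.md` (both `absent`,
"= (A3) of Prop A1 with α = ∂" / "= Cor A2 (A4) + (A2) with α = ∂, B = L^{−d/2}Q^{e*}F"); fourth sibling file of seat p30
(`BIJ85Eq611Proof`, `BIJ85Eq625Proof`, `BIJ85Eq427Proof`), unit `lit-balaban-p30`.

THE PRINTED TEXT (verbatim, p. 307 [PDF 9]).  *"Then the Wilson action can be written Σ_{p∈T₁} e(ε)^{−2}(1 − Re u(p)) =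
½Σ_{p∈T₁}|∂A′ + L^{−d/2}Q^{e*}F|² + O(e(ε)²). (3.13) … The quadratic form in (3.13) can be reexpressed by translating to its
minimum. By the Appendix, with α = ∂ and B = L^{−d/2}Q^{e*}F, we have A_cl = −L^{−d/2}C∂^*Q^{e*}F. (3.15)  Here C = (∂^*∂)^{−1},
restricted to the subspace of A satisfying both QA = 0 and the axial gauge condition. Then by Corollary A2, and
A′ = A + A_cl, (3.16)  ½Σ_{p∈T₁}|∂A′ + L^{−d/2}Q^{e*}F|² = ½Σ_{p∈T₁}|∂A|² + ½⟨F,ΣF⟩, (3.17) where Σ = L^{−d}Q^e(I − ∂C∂^*)Q^{e*}.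
(3.18)  The fluctuation field A lives on the unit lattice, and will be integrated."*  Appendix inputs (p. 326–327, tree
`BIJ85AppAStatements`): (A1) h(A) = ½‖αA + B‖² = `hForm`; Prop. A1 (A2)–(A3) "h(A) ≥ h(A_cl) = ½⟨B,(I−P)B⟩, A_cl = −Δ^{−1}α^*B"
= `propA1_min`, `hForm_min_eq`; Cor. A2 (A4) "h(A) = ½⟨A′,ΔA′⟩ + h(A_cl)" = `corA2`.

THE TYPING.  `E` = the subspace ℋ₀ of unit-lattice bond fields A with QA = 0 in the axial gauge, as a real inner product
space of its own (the constraint is the instance's type); `P₁` = unit-lattice plaquette fields, `PL` = L-lattice plaquette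
fields (F); `α : E →ₗ P₁` = ∂ restricted to ℋ₀ with adjoint `αadj` = ∂^* (followed by the projection onto ℋ₀) — the pair
(α, α^*) of (A1) — `hadj`; `C : E →ₗ E` = (∂^*∂)^{−1} on ℋ₀, typed by `hC` : ∂^*∂C = I on ℋ₀ (its existence is the no-zero-modes
claim of p. 309, row C1.Eq4.1.1-4.1.2); `Qe`/`Qes` = Q^e/Q^{e*} (adjoint pair `hQe`, (2.21)–(2.22)); L^{−d/2} = `l`; Σ as data with
`h318` : Σ = l²·Q^e(I − ∂C∂^*)Q^{e*} (l² = L^{−d}).  WHAT IS PROVED: `C_symm` (C symmetric, from `hC` + `hadj`), `normal315`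
(A_cl of (3.15) solves the normal equation α^*(αA_cl + B) = 0 of (A3)), `eq315_min` (A_cl minimises h, Prop. A1), `res315`
(αA_cl + B = (I − ∂C∂^*)B with I − ∂C∂^* a self-adjoint projection, the "(I − P)B" of (A2)), **`eq317`** ((3.17) with (3.18)).
Carrier clauses (F6): the lattice maps ∂, Q^e, the constraint subspace and C itself are the instance's; NOTHING of the paper
is asserted beyond the kernel-checked algebra below.
-/

open scoped RealInnerProductSpace

namespace Literature.MathematicalPhysics.QuantumFieldTheory.BalabanImbrieJaffe1984to88.BIJ85Eq317Proof

open BIJ85AppAStatements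

variable {E : Type*} [NormedAddCommGroup E] [InnerProductSpace ℝ E]
variable {P₁ : Type*} [NormedAddCommGroup P₁] [InnerProductSpace ℝ P₁]
variable {PL : Type*} [NormedAddCommGroup PL] [InnerProductSpace ℝ PL]

/-- *"Here C = (∂^*∂)^{−1}, restricted to the subspace of A satisfying both QA = 0 and the axial gauge condition"* (p. 307):
from ∂^*∂C = I on ℋ₀ (`hC`) and the adjointness of ∂, ∂^* (`hadj`), C is SYMMETRIC: ⟨Cx, y⟩ = ⟨∂Cx, ∂Cy⟩ = ⟨x, Cy⟩.
[cite: BalabanImbrieJaffe1985, (3.15) p.307] -/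
theorem C_symm (α : E →ₗ[ℝ] P₁) (αadj : P₁ →ₗ[ℝ] E) (hadj : ∀ (x : E) (y : P₁), ⟪α x, y⟫ = ⟪x, αadj y⟫)
    (C : E →ₗ[ℝ] E) (hC : ∀ x : E, αadj (α (C x)) = x) (x y : E) : ⟪C x, y⟫ = ⟪x, C y⟫ := by
  have h1 : ⟪C x, y⟫ = ⟪α (C x), α (C y)⟫ := by
    conv_lhs => rw [← hC y]
    rw [← hadj]
  have h2 : ⟪x, C y⟫ = ⟪α (C x), α (C y)⟫ := by
    conv_lhs => rw [← hC x]
    rw [real_inner_comm, ← hadj, real_inner_comm]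
  rw [h1, h2]

/-- **(3.15)** p. 307 [PDF 9], verbatim: *"By the Appendix, with α = ∂ and B = L^{−d/2}Q^{e*}F, we have A_cl = −L^{−d/2}C∂^*Q^{e*}F.
(3.15)"* — this A_cl = −Δ^{−1}α^*B ((A3), Δ = α^*α = ∂^*∂, Δ^{−1} = C on ℋ₀) solves the NORMAL EQUATION α^*(αA_cl + B) = 0 of
Proposition A1 (the hypothesis `hnormal` of `BIJ85AppAStatements.corA2` / `propA1_min`), by ∂^*∂C = I (`hC`); L^{−d/2} = `l`.
[cite: BalabanImbrieJaffe1985, (3.15) p.307] -/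
theorem normal315 (α : E →ₗ[ℝ] P₁) (αadj : P₁ →ₗ[ℝ] E) (C : E →ₗ[ℝ] E) (hC : ∀ x : E, αadj (α (C x)) = x)
    (Qes : PL →ₗ[ℝ] P₁) (l : ℝ) (F : PL) :
    αadj (α (-(l • C (αadj (Qes F)))) + l • Qes F) = 0 := by
  rw [map_neg, map_smul, map_add, map_neg, map_smul, hC, map_smul, neg_add_cancel]

/-- **(3.15) is the minimum** (p. 307: *"The quadratic form in (3.13) can be reexpressed by translating to its minimum"*):
h(A) = ½‖∂A + L^{−d/2}Q^{e*}F‖² ≥ h(A_cl) for every A ∈ ℋ₀, A_cl = −L^{−d/2}C∂^*Q^{e*}F — Proposition A1 (A2)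
(`BIJ85AppAStatements.propA1_min`) with α = ∂, B = L^{−d/2}Q^{e*}F. [cite: BalabanImbrieJaffe1985, (3.15) p.307] -/
theorem eq315_min (α : E →ₗ[ℝ] P₁) (αadj : P₁ →ₗ[ℝ] E) (hadj : ∀ (x : E) (y : P₁), ⟪α x, y⟫ = ⟪x, αadj y⟫)
    (C : E →ₗ[ℝ] E) (hC : ∀ x : E, αadj (α (C x)) = x) (Qes : PL →ₗ[ℝ] P₁) (l : ℝ) (F : PL) (A : E) :
    hForm α (l • Qes F) (-(l • C (αadj (Qes F)))) ≤ hForm α (l • Qes F) A :=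
  propA1_min α αadj hadj (l • Qes F) (-(l • C (αadj (Qes F)))) (normal315 α αadj C hC Qes l F) A

/-- At the minimum (3.15): ∂A_cl + B = (I − ∂C∂^*)B for B = L^{−d/2}Q^{e*}F, and I − ∂C∂^* is a SELF-ADJOINT PROJECTION on
unit-lattice plaquette fields (C symmetric, ∂^*∂C = I) — the "(I − P)B, P the projection onto Range α" of Proposition A1
(A2) p. 327 in the present instance (`Qop` = I − ∂C∂^*, `hQop`). [cite: BalabanImbrieJaffe1985, (3.15) p.307] -/
theorem res315 (α : E →ₗ[ℝ] P₁) (αadj : P₁ →ₗ[ℝ] E) (hadj : ∀ (x : E) (y : P₁), ⟪α x, y⟫ = ⟪x, αadj y⟫)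
    (C : E →ₗ[ℝ] E) (hC : ∀ x : E, αadj (α (C x)) = x) (Qes : PL →ₗ[ℝ] P₁) (l : ℝ) (F : PL)
    (Qop : P₁ →ₗ[ℝ] P₁) (hQop : Qop = LinearMap.id - α ∘ₗ C ∘ₗ αadj) :
    α (-(l • C (αadj (Qes F)))) + l • Qes F = Qop (l • Qes F) ∧
    (∀ x y : P₁, ⟪Qop x, y⟫ = ⟪x, Qop y⟫) ∧ (∀ x : P₁, Qop (Qop x) = Qop x) := by
  subst hQop
  refine ⟨?_, fun x y => ?_, fun x => ?_⟩
  · rw [map_neg, map_smul, LinearMap.sub_apply, LinearMap.id_apply, LinearMap.comp_apply, LinearMap.comp_apply,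
      map_smul, map_smul, map_smul, neg_add_eq_sub]
  · simp only [LinearMap.sub_apply, LinearMap.id_apply, LinearMap.comp_apply, inner_sub_left, inner_sub_right]
    congr 1
    rw [hadj, C_symm α αadj hadj C hC, real_inner_comm (C (αadj y)) (αadj x), ← hadj]
    exact real_inner_comm x (α (C (αadj y)))
  · simp [hC]

/-- **(3.16)–(3.18)** p. 307 [PDF 9], verbatim: *"Then by Corollary A2, and A′ = A + A_cl, (3.16)
½Σ_{p∈T₁}|∂A′ + L^{−d/2}Q^{e*}F|² = ½Σ_{p∈T₁}|∂A|² + ½⟨F,ΣF⟩, (3.17) where Σ = L^{−d}Q^e(I − ∂C∂^*)Q^{e*}. (3.18)"* — PROVED by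
instantiating Corollary A2 (A4) (`BIJ85AppAStatements.corA2`: h(A′ + A_cl) = ½⟨A′,ΔA′⟩ + h(A_cl), here ½⟨A,∂^*∂A⟩ = ½‖∂A‖²) and
Proposition A1 (A2) (`hForm_min_eq`: h(A_cl) = ½⟨B,(I−P)B⟩ with I − P = I − ∂C∂^*, `res315`), and the adjoint pair Q^e/Q^{e*}
((2.21)–(2.22), `hQe`): ½⟨B,(I − ∂C∂^*)B⟩ = ½L^{−d}⟨F, Q^e(I − ∂C∂^*)Q^{e*}F⟩ = ½⟨F,ΣF⟩ (`h318`, l = L^{−d/2}, l² = L^{−d}); the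
left side ½Σ|∂A′ + L^{−d/2}Q^{e*}F|² is `hForm` (A1) at A′ = A + A_cl, A_cl = −L^{−d/2}C∂^*Q^{e*}F (3.15).
[cite: BalabanImbrieJaffe1985, (3.16)–(3.18) p.307] -/
theorem eq317 (α : E →ₗ[ℝ] P₁) (αadj : P₁ →ₗ[ℝ] E) (hadj : ∀ (x : E) (y : P₁), ⟪α x, y⟫ = ⟪x, αadj y⟫)
    (C : E →ₗ[ℝ] E) (hC : ∀ x : E, αadj (α (C x)) = x) (Qe : P₁ →ₗ[ℝ] PL) (Qes : PL →ₗ[ℝ] P₁)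
    (hQe : ∀ (f : P₁) (g : PL), ⟪Qe f, g⟫ = ⟪f, Qes g⟫) (l : ℝ) (Sig : PL →ₗ[ℝ] PL)
    (h318 : Sig = (l ^ 2) • (Qe ∘ₗ (LinearMap.id - α ∘ₗ C ∘ₗ αadj) ∘ₗ Qes)) (F : PL) (A : E) :
    hForm α (l • Qes F) (A + -(l • C (αadj (Qes F)))) = (1 / 2) * ‖α A‖ ^ 2 + (1 / 2) * ⟪F, Sig F⟫ := by
  obtain ⟨hres, hself, hidem⟩ := res315 α αadj hadj C hC Qes l F _ rfl
  have key : ∀ u : P₁, ⟪F, Qe u⟫ = ⟪Qes F, u⟫ := fun u => by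
    rw [real_inner_comm (Qe u) F, hQe]
    exact real_inner_comm (Qes F) u
  rw [corA2 α αadj hadj (l • Qes F) (-(l • C (αadj (Qes F)))) (normal315 α αadj C hC Qes l F) A,
    hForm_min_eq α (l • Qes F) (-(l • C (αadj (Qes F)))) _ hself hidem hres, ← hadj,
    real_inner_self_eq_norm_sq, h318]
  simp only [LinearMap.smul_apply, LinearMap.comp_apply, map_smul, real_inner_smul_left, real_inner_smul_right, key]
  ring

end Literature.MathematicalPhysics.QuantumFieldTheory.BalabanImbrieJaffe1984to88.BIJ85Eq317Proof
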